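import Summits.QuantumFields.BalabanUV.T4Continuum.Support.CovariantVectorCoerciveHoloForm
import Summits.QuantumFields.BalabanUV.T4Continuum.Support.CovariantVectorGreenDecay

/-!
# T⁴ programme, SUBSTRATE (shared lattice-gauge analysis library) — CONJUGATION DEFECTS OF THE CHART PIECES, I (Laplacian): along the
# exponential chart `(e^{A}R⁰, (R⁰)⁻¹e^{−A})` the Laplacian perturbation of the two-sided fluctuation operator off its real slice has a
# Combes–Thomas conjugation defect of FIRST order in the weight with LEVEL-FREE size (one power of `n` eaten by `n‖A‖`), in the operator-norm
# currency of `CTWeightedCoercivity` (typer LIBRARY-v0.1 item W-9 ∕ L-A7, file 1 of 4)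

Substrate cell `b2b-balaban-substrate-*`, seat p3 (gen 2).  Off the real slice the operator `ΔQ_n(e^{A}R⁰, (R⁰)⁻¹e^{−A})`
(`SubstrateTransporterSpecies.deltaQT`) is NOT Hermitian, so the Hermitian engine `Beta.DeltaACombesThomas.combesThomas_pairwise_inv` of J-3b
(`CovariantVectorGreenDecay`) does not apply; the ACCRETIVE engine (`Beta.AccretiveCombesThomas`, through VEC-1's `CTWeightedCoercivity.WCoercive ∕
ConjDefect`) wants a `Re`-coercivity (HoloForm's `coercive_deltaQT_of_norm_lt_rho1`, file 3 `CovariantVectorGreenDecayChart`) and a CONJUGATION DEFECT.  By the exact factorisation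
`CovariantVectorChartFactorisation.cross_expand` the chart operator is the real slice `vecOp n M a′ Γ R⁰` (Hermitian: cosh budget, file 3) PLUS
the Laplacian perturbation `Σ_ν [c·D_νᴴN_ν(M_ν − 1) + c̄·(N_ν − 1)M_νD_ν + |c|²(N_ν − 1)(M_ν − 1)]` (`D_ν = ∇_ν(R⁰)`, `M_ν, N_ν` SITE-DIAGONAL; this
file) PLUS the averaging perturbation `a′n^d·(Qᴬ((R⁰)⁻¹e^{−A})·Q(e^{A}R⁰) − Q(R⁰)ᴴQ(R⁰))` (file 2 `CovariantVectorChartConjugationAvg`).  For a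
bond weight `ρ` that is `1/n`-Lipschitz along fine bonds (lifted to colour, `CovariantVectorCTDefects.rhoV`):
 * §1 `conjMat_of_siteDiag` ∕ `conjMat_siteMul` (site-diagonal kernels are conjugation-invariant), `conjMat_finset_sum`, `kronShift_apply`,
   **`opNorm_conjMat_kronShift_sub_le`** (`‖W(S_ν ⊗ 1)W⁻¹ − S_ν ⊗ 1‖ ≤ e^{|κ|/n} − 1`, Schur via `CTConjugationPieces.opNorm_conjMat_sub_le_schur`) and
   its adjoint, **`opNorm_conjMat_covDc_sub_le`** ∕ `…covDcA…` (`≤ ‖c‖·(e^{|κ|/n} − 1)` for transporters of norm `≤ 1`);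
 * §2 **`covLapT_chart_sub_eq`** (the Laplacian perturbation, from `cross_expand` + `adjOf_eq_inv`), **`opNorm_conjMat_lapTerm_sub_le`**
   (`≤ 2‖c‖²(e^{|κ|/n} − 1)·δ(1 + δ)` per direction, `‖M_ν − 1‖, ‖N_ν − 1‖ ≤ δ`), **`conjDefect_covLapT_chart`** (`δ = ‖A‖e^{‖A‖}`, summed over `ν`).
HONEST FRAMING (T4-DAG p. 1).  MODEL-level finite-dimensional linear algebra ([folklore]; constants OURS and crude); no estimate of any NE row;
nothing printed is a hypothesis; no `def`; spine 0/9 unchanged; NOT infinite volume ∕ mass gap ∕ Clay.  HONEST DEPENDENCY: continuum YM on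
T⁴ ⇐ BetaPertH ∧ nine spine estimates (0/9 proved); BetaPertH ⇐ (D1) ∧ (D4) ∧ CAP+tail; G-an2-4 gates asym, D1 and NE2/3/4.  ABSOLUTE RULE kept;
no `sorry`.
-/

noncomputable section

open scoped BigOperators ComplexConjugate Matrix Matrix.Norms.L2Operator Kronecker ComplexOrder

namespace Summit.QuantumFields.BalabanUV.T4Continuum.CovariantVectorChartConjugation

open Literature.MathematicalPhysics.QuantumFieldTheory.Balaban1983to89.B5Prop11Plancherel (Tor fine unitVec shiftM)
open Literature.MathematicalPhysics.QuantumFieldTheory.Balaban1983to89.B5Block118 (bpt tstep)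
open Literature.MathematicalPhysics.QuantumFieldTheory.Balaban1983to89.Beta.DeltaACombesThomas (qr qr_nonneg qr_ne_zero sum_qr_row sum_qr_col)
open Summit.QuantumFields.BalabanUV.T4Continuum
open Summit.QuantumFields.BalabanUV.T4Continuum.BlockMultiplication (siteMul siteMul_apply siteMul_sub siteMul_one siteMul_mul opNorm_siteMul_le)
open Summit.QuantumFields.BalabanUV.T4Continuum.KroneckerUnits (norm_entry_le)
open Summit.QuantumFields.BalabanUV.T4Continuum.ColourCovariantLaplacian (covDc covLapC)
open Summit.QuantumFields.BalabanUV.T4Continuum.CovariantBlockAveraging (transport ContourSystem Qcov opNorm_le_sqrt_of_schur)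
open Summit.QuantumFields.BalabanUV.T4Continuum.SubstrateTransporterSpecies
open Summit.QuantumFields.BalabanUV.T4Continuum.CovariantVectorCTDefects (rhoV norm_Qcov_apply_le)
open Summit.QuantumFields.BalabanUV.T4Continuum.CovariantVectorChartModulus
open Summit.QuantumFields.BalabanUV.T4Continuum.CovariantVectorChartFactorisation
open Summit.QuantumFields.BalabanUV.T4Continuum.CovariantVectorCoerciveHoloForm (opNorm_Mfac_sub_one_le opNorm_Nfac_sub_one_le opNorm_le_one_add)
open Summit.QuantumFields.BalabanUV.T4Continuum.CTWeightedCoercivity (conjMat conjMat_apply conjMat_add conjMat_sub conjMat_smul conjMat_mul conjMat_one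
  ConjDefect conjDefect_of_opNorm)
open Summit.QuantumFields.BalabanUV.T4Continuum.CTConjugationPieces (conjMat_conjTranspose opNorm_conjMat_sub_le_schur)

variable {d : ℕ} {o : Type*} [Fintype o] [DecidableEq o] [Nonempty o]

/-! ## §1 Conjugation of site-diagonal kernels, of the bond translation and of the covariant differences -/

section Generic

variable (n : ℕ) [NeZero n] (M : Fin d → ℕ) [hM : ∀ μ, NeZero (M μ)]
variable {ρ : Tor (fine n M) × Fin d → ℝ} {κ : ℝ}

omit [Fintype o] [DecidableEq o] [Nonempty o] [NeZero n] hM in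
/-- a kernel that is diagonal in the bond index (`A i j = 0` unless `i.1 = j.1`) is invariant under conjugation by a weight depending on the bond
only. [folklore] -/
theorem conjMat_of_siteDiag (A : Matrix ((Tor (fine n M) × Fin d) × o) ((Tor (fine n M) × Fin d) × o) ℂ) (hA : ∀ i j, i.1 ≠ j.1 → A i j = 0)
    (κ : ℝ) (ρ : Tor (fine n M) × Fin d → ℝ) : conjMat κ (rhoV n M ρ) (rhoV n M ρ) A = A := by
  ext i j
  rw [conjMat_apply]
  by_cases h : i.1 = j.1
  · simp only [rhoV, h, sub_self, mul_zero, Real.exp_zero, Complex.ofReal_one, one_mul]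
  · rw [hA i j h, mul_zero]

omit [Fintype o] [DecidableEq o] [Nonempty o] [NeZero n] hM in
/-- `siteMul w` is conjugation-invariant. [folklore] -/
theorem conjMat_siteMul (w : Tor (fine n M) × Fin d → Matrix o o ℂ) (κ : ℝ) (ρ : Tor (fine n M) × Fin d → ℝ) :
    conjMat κ (rhoV n M ρ) (rhoV n M ρ) (siteMul w) = siteMul w :=
  conjMat_of_siteDiag n M _ (fun i j h => by rw [siteMul_apply, if_neg h]) κ ρ

omit [Fintype o] [DecidableEq o] [Nonempty o] [NeZero n] hM in
/-- conjugation of a finite sum. [folklore] -/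
theorem conjMat_finset_sum {ι τ σ : Type*} (s : Finset ι) (κ : ℝ) (ρ : τ → ℝ) (σ' : σ → ℝ) (X : ι → Matrix τ σ ℂ) :
    conjMat κ ρ σ' (∑ x ∈ s, X x) = ∑ x ∈ s, conjMat κ ρ σ' (X x) := by
  ext e e'
  simp only [conjMat_apply, Matrix.sum_apply, Finset.mul_sum]

omit [Fintype o] [Nonempty o] [NeZero n] hM in
/-- entries of the lifted bond translation. [folklore] -/
theorem kronShift_apply (ν : Fin d) (i j : (Tor (fine n M) × Fin d) × o) :
    (shiftM (fine n M) ν ⊗ₖ (1 : Matrix o o ℂ)) i j = if j = ((i.1.1 + unitVec (fine n M) ν, i.1.2), i.2) then 1 else 0 := by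
  rw [Matrix.kroneckerMap_apply, shiftM, Matrix.one_apply]
  by_cases h : j = ((i.1.1 + unitVec (fine n M) ν, i.1.2), i.2)
  · rw [if_pos h, h]; simp
  · rw [if_neg h]
    by_cases h1 : j.1 = (i.1.1 + unitVec (fine n M) ν, i.1.2)
    · have h2 : i.2 ≠ j.2 := fun h2 => h (Prod.ext h1 h2.symm)
      rw [if_neg h2, mul_zero]
    · rw [if_neg h1, zero_mul]

omit [Nonempty o] in
/-- **CONJUGATION OF THE BOND TRANSLATION**: `‖W(S_ν ⊗ 1)W⁻¹ − S_ν ⊗ 1‖ ≤ e^{|κ|/n} − 1` for a `1/n`-Lipschitz bond weight. [folklore] -/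
theorem opNorm_conjMat_kronShift_sub_le (hlip : ∀ x μ ν', |ρ (x + unitVec (fine n M) ν', μ) - ρ (x, μ)| ≤ 1 / n) (κ : ℝ) (ν : Fin d) :
    ‖conjMat κ (rhoV n M ρ) (rhoV n M ρ) (shiftM (fine n M) ν ⊗ₖ (1 : Matrix o o ℂ)) - shiftM (fine n M) ν ⊗ₖ (1 : Matrix o o ℂ)‖
      ≤ Real.exp (|κ| * (1 / n)) - 1 := by
  have h := opNorm_conjMat_sub_le_schur κ (rhoV n M ρ) (rhoV n M ρ) (shiftM (fine n M) ν ⊗ₖ (1 : Matrix o o ℂ)) (ℓ := 1 / n) (R := 1) (C := 1)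
    (by positivity) zero_le_one zero_le_one ?_ ?_ ?_
  · simpa using h
  · intro i j hij
    rw [kronShift_apply] at hij
    by_cases hj : j = ((i.1.1 + unitVec (fine n M) ν, i.1.2), i.2)
    · simp only [rhoV, hj]
      rw [abs_sub_comm]
      exact hlip i.1.1 i.1.2 ν
    · exact absurd (if_neg hj) hij
  · intro i
    rw [Finset.sum_eq_single ((i.1.1 + unitVec (fine n M) ν, i.1.2), i.2)]
    · rw [kronShift_apply, if_pos rfl, norm_one]
    · intro j _ hj; rw [kronShift_apply, if_neg hj, norm_zero]
    · intro h; exact absurd (Finset.mem_univ _) h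
  · intro j
    rw [Finset.sum_eq_single ((j.1.1 - unitVec (fine n M) ν, j.1.2), j.2)]
    · rw [kronShift_apply]; simp
    · intro i _ hi
      rw [kronShift_apply, if_neg, norm_zero]
      intro hj
      apply hi
      rw [hj]; simp
    · intro h; exact absurd (Finset.mem_univ _) h

omit [Nonempty o] in
/-- the adjoint bond translation: `‖W(S_ν ⊗ 1)ᴴW⁻¹ − (S_ν ⊗ 1)ᴴ‖ ≤ e^{|κ|/n} − 1`. [folklore] -/
theorem opNorm_conjMat_kronShift_adj_sub_le (hlip : ∀ x μ ν', |ρ (x + unitVec (fine n M) ν', μ) - ρ (x, μ)| ≤ 1 / n) (κ : ℝ) (ν : Fin d) :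
    ‖conjMat κ (rhoV n M ρ) (rhoV n M ρ) (shiftM (fine n M) ν ⊗ₖ (1 : Matrix o o ℂ))ᴴ - (shiftM (fine n M) ν ⊗ₖ (1 : Matrix o o ℂ))ᴴ‖
      ≤ Real.exp (|κ| * (1 / n)) - 1 := by
  rw [conjMat_conjTranspose, ← Matrix.conjTranspose_sub, Matrix.l2_opNorm_conjTranspose]
  have h := opNorm_conjMat_kronShift_sub_le n M (o := o) hlip (-κ) ν
  rwa [abs_neg] at h

variable {c : ℂ}

omit [Nonempty o] in
/-- **CONJUGATION OF THE COVARIANT DIFFERENCE**: `‖W∇_ν(R)W⁻¹ − ∇_ν(R)‖ ≤ ‖c‖·(e^{|κ|/n} − 1)` for transporters of norm `≤ 1`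
(`∇_ν(R) = c·(siteMul(R_ν)(S_ν ⊗ 1) − 1)`; the site-diagonal factor is conjugation-invariant). [folklore] -/
theorem opNorm_conjMat_covDc_sub_le (hlip : ∀ x μ ν', |ρ (x + unitVec (fine n M) ν', μ) - ρ (x, μ)| ≤ 1 / n) (κ : ℝ)
    {R : Fin d → (Tor (fine n M) × Fin d → Matrix o o ℂ)} (ν : Fin d) (hR : ∀ i, ‖R ν i‖ ≤ 1) :
    ‖conjMat κ (rhoV n M ρ) (rhoV n M ρ) (covDc (fine n M) c R ν) - covDc (fine n M) c R ν‖ ≤ ‖c‖ * (Real.exp (|κ| * (1 / n)) - 1) := by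
  have hθ : 0 ≤ Real.exp (|κ| * (1 / n)) - 1 := by linarith [Real.one_le_exp (by positivity : 0 ≤ |κ| * (1 / (n : ℝ)))]
  have e : conjMat κ (rhoV n M ρ) (rhoV n M ρ) (covDc (fine n M) c R ν) - covDc (fine n M) c R ν
      = c • (siteMul (R ν) * (conjMat κ (rhoV n M ρ) (rhoV n M ρ) (shiftM (fine n M) ν ⊗ₖ (1 : Matrix o o ℂ)) - shiftM (fine n M) ν ⊗ₖ 1)) := by
    rw [covDc, conjMat_smul, ← smul_sub, conjMat_sub, conjMat_one, sub_sub_sub_cancel_right,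
      conjMat_mul κ _ (rhoV n M ρ) _ (siteMul (R ν)), conjMat_siteMul, ← Matrix.mul_sub]
  rw [e, norm_smul]
  refine mul_le_mul_of_nonneg_left ((Matrix.l2_opNorm_mul _ _).trans ?_) (norm_nonneg _)
  exact (mul_le_mul (opNorm_siteMul_le _ zero_le_one hR) (opNorm_conjMat_kronShift_sub_le n M hlip κ ν) (norm_nonneg _) zero_le_one).trans
    (by rw [one_mul])

omit [Nonempty o] in
/-- **CONJUGATION OF THE ADJOINT COVARIANT DIFFERENCE**: `‖W∇ᴬ_ν(S)W⁻¹ − ∇ᴬ_ν(S)‖ ≤ ‖c‖·(e^{|κ|/n} − 1)` for transporters of norm `≤ 1`.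
[folklore] -/
theorem opNorm_conjMat_covDcA_sub_le (hlip : ∀ x μ ν', |ρ (x + unitVec (fine n M) ν', μ) - ρ (x, μ)| ≤ 1 / n) (κ : ℝ)
    {S : Fin d → (Tor (fine n M) × Fin d → Matrix o o ℂ)} (ν : Fin d) (hS : ∀ i, ‖S ν i‖ ≤ 1) :
    ‖conjMat κ (rhoV n M ρ) (rhoV n M ρ) (covDcA (fine n M) c S ν) - covDcA (fine n M) c S ν‖ ≤ ‖c‖ * (Real.exp (|κ| * (1 / n)) - 1) := by
  have e : conjMat κ (rhoV n M ρ) (rhoV n M ρ) (covDcA (fine n M) c S ν) - covDcA (fine n M) c S ν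
      = (starRingEnd ℂ) c • ((conjMat κ (rhoV n M ρ) (rhoV n M ρ) (shiftM (fine n M) ν ⊗ₖ (1 : Matrix o o ℂ))ᴴ - (shiftM (fine n M) ν ⊗ₖ 1)ᴴ)
          * siteMul (S ν)) := by
    rw [covDcA, conjMat_smul, ← smul_sub, conjMat_sub, conjMat_one, sub_sub_sub_cancel_right,
      conjMat_mul κ _ (rhoV n M ρ) _ _ (siteMul (S ν)), conjMat_siteMul, ← Matrix.sub_mul]
  rw [e, norm_smul, Complex.norm_conj]
  refine mul_le_mul_of_nonneg_left ((Matrix.l2_opNorm_mul _ _).trans ?_) (norm_nonneg _)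
  have hθ : 0 ≤ Real.exp (|κ| * (1 / n)) - 1 := by linarith [Real.one_le_exp (by positivity : 0 ≤ |κ| * (1 / (n : ℝ)))]
  exact (mul_le_mul (opNorm_conjMat_kronShift_adj_sub_le n M hlip κ ν) (opNorm_siteMul_le _ zero_le_one hS) (norm_nonneg _) hθ).trans
    (by rw [mul_one])

end Generic

/-! ## §2 The Laplacian chart perturbation -/

section Laplacian

variable (n : ℕ) [NeZero n] (M : Fin d → ℕ) [hM : ∀ μ, NeZero (M μ)]
variable {ρ : Tor (fine n M) × Fin d → ℝ} {κ : ℝ} {R₀ : Fin d → (Tor (fine n M) × Fin d → Matrix o o ℂ)}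

omit [Nonempty o] in
/-- **THE LAPLACIAN CHART PERTURBATION**: for unitary `R⁰`,
`Δ(e^{A}R⁰, (R⁰)⁻¹e^{−A}) − Δ_{R⁰} = Σ_ν [c·D_νᴴN_ν(M_ν − 1) + c̄·(N_ν − 1)M_νD_ν + (c̄c)·(N_ν − 1)(M_ν − 1)]` with `D_ν = ∇_ν(R⁰)`,
`D_νᴴ = ∇ᴬ_ν((R⁰)ᴴ)` (`cross_expand` + `adjOf_eq_inv`: the Gram part `D_νᴴD_ν` is EXACTLY the real slice's). [folklore] -/
theorem covLapT_chart_sub_eq (hR₀ : ∀ ν i, R₀ ν i ∈ Matrix.unitaryGroup o ℂ) (c : ℂ) (A : Fin d → (Tor (fine n M) × Fin d → Matrix o o ℂ)) :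
    covLapT (fine n M) c (expChart R₀ A) (expChartInv R₀ A) - covLapC (fine n M) c R₀
      = ∑ ν, (c • (covDcA (fine n M) c (adjOf R₀) ν * (Nfac (fine n M) A ν * (Mfac (fine n M) A ν - 1)))
          + (starRingEnd ℂ) c • ((Nfac (fine n M) A ν - 1) * Mfac (fine n M) A ν * covDc (fine n M) c R₀ ν)
          + ((starRingEnd ℂ) c * c) • ((Nfac (fine n M) A ν - 1) * (Mfac (fine n M) A ν - 1))) := by
  rw [← covLapT_adjOf, covLapT, covLapT, ← Finset.sum_sub_distrib]
  refine Finset.sum_congr rfl fun ν _ => ?_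
  rw [cross_expand, ← adjOf_eq_inv hR₀]
  abel

/-- **CONJUGATION DEFECT OF ONE LAPLACIAN TERM**: `≤ 2‖c‖²·(e^{|κ|/n} − 1)·δ·(1 + δ)` when `‖M_ν − 1‖, ‖N_ν − 1‖ ≤ δ` (unitary `R⁰`,
`1/n`-Lipschitz weight; the site-diagonal term has no defect). [folklore] -/
theorem opNorm_conjMat_lapTerm_sub_le (hR₀ : ∀ ν i, R₀ ν i ∈ Matrix.unitaryGroup o ℂ)
    (hlip : ∀ x μ ν', |ρ (x + unitVec (fine n M) ν', μ) - ρ (x, μ)| ≤ 1 / n) (κ : ℝ) (c : ℂ)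
    (A : Fin d → (Tor (fine n M) × Fin d → Matrix o o ℂ)) (ν : Fin d) {δ : ℝ} (hδ : 0 ≤ δ)
    (hM1 : ‖Mfac (fine n M) A ν - 1‖ ≤ δ) (hN1 : ‖Nfac (fine n M) A ν - 1‖ ≤ δ) :
    ‖conjMat κ (rhoV n M ρ) (rhoV n M ρ)
        (c • (covDcA (fine n M) c (adjOf R₀) ν * (Nfac (fine n M) A ν * (Mfac (fine n M) A ν - 1)))
          + (starRingEnd ℂ) c • ((Nfac (fine n M) A ν - 1) * Mfac (fine n M) A ν * covDc (fine n M) c R₀ ν)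
          + ((starRingEnd ℂ) c * c) • ((Nfac (fine n M) A ν - 1) * (Mfac (fine n M) A ν - 1)))
      - (c • (covDcA (fine n M) c (adjOf R₀) ν * (Nfac (fine n M) A ν * (Mfac (fine n M) A ν - 1)))
          + (starRingEnd ℂ) c • ((Nfac (fine n M) A ν - 1) * Mfac (fine n M) A ν * covDc (fine n M) c R₀ ν)
          + ((starRingEnd ℂ) c * c) • ((Nfac (fine n M) A ν - 1) * (Mfac (fine n M) A ν - 1)))‖
      ≤ 2 * ‖c‖ ^ 2 * (Real.exp (|κ| * (1 / n)) - 1) * (δ * (1 + δ)) := by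
  set θ : ℝ := Real.exp (|κ| * (1 / n)) - 1 with hθdef
  have hθ : 0 ≤ θ := by rw [hθdef]; linarith [Real.one_le_exp (by positivity : 0 ≤ |κ| * (1 / (n : ℝ)))]
  have hne : Nonempty ((Tor (fine n M) × Fin d) × o) := by
    rcases isEmpty_or_nonempty (Fin d) with hd | hd
    · exact (IsEmpty.false ν).elim
    · infer_instance
  set D := covDc (fine n M) c R₀ ν with hD
  set Da := covDcA (fine n M) c (adjOf R₀) ν with hDa
  set Mm := Mfac (fine n M) A ν with hMm
  set Nn := Nfac (fine n M) A ν with hNn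
  set W := rhoV n M (o := o) ρ with hW
  -- the site-diagonal factors are conjugation-invariant
  have hcM : conjMat κ W W Mm = Mm := by rw [hMm, Mfac, hW, conjMat_siteMul]
  have hcN : conjMat κ W W Nn = Nn := by rw [hNn, Nfac, hW, conjMat_siteMul]
  have hc1 : conjMat κ W W (1 : Matrix ((Tor (fine n M) × Fin d) × o) ((Tor (fine n M) × Fin d) × o) ℂ) = 1 := conjMat_one κ W
  set X := Nn * (Mm - 1) with hX
  set Y := (Nn - 1) * Mm with hY
  set Z := (Nn - 1) * (Mm - 1) with hZ
  have hcX : conjMat κ W W X = X := by rw [hX, conjMat_mul κ W W W, hcN, conjMat_sub, hcM, hc1]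
  have hcY : conjMat κ W W Y = Y := by rw [hY, conjMat_mul κ W W W, conjMat_sub, hcN, hc1, hcM]
  have hcZ : conjMat κ W W Z = Z := by rw [hZ, conjMat_mul κ W W W, conjMat_sub, conjMat_sub, hcN, hcM, hc1]
  -- the difference
  have e : conjMat κ W W (c • (Da * X) + (starRingEnd ℂ) c • (Y * D) + ((starRingEnd ℂ) c * c) • Z)
      - (c • (Da * X) + (starRingEnd ℂ) c • (Y * D) + ((starRingEnd ℂ) c * c) • Z)
      = c • ((conjMat κ W W Da - Da) * X) + (starRingEnd ℂ) c • (Y * (conjMat κ W W D - D)) := by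
    rw [conjMat_add, conjMat_add, conjMat_smul, conjMat_smul, conjMat_smul, conjMat_mul κ W W W Da, hcX, conjMat_mul κ W W W Y, hcY, hcZ,
      Matrix.sub_mul, Matrix.mul_sub, smul_sub, smul_sub]
    abel
  rw [e]
  have hR' : ∀ i, ‖R₀ ν i‖ ≤ 1 := fun i => (norm_of_unitary (hR₀ ν i)).le
  have hS' : ∀ i, ‖adjOf R₀ ν i‖ ≤ 1 := fun i => by rw [adjOf_apply, Matrix.l2_opNorm_conjTranspose]; exact hR' i
  have h1 : ‖conjMat κ W W Da - Da‖ ≤ ‖c‖ * θ := opNorm_conjMat_covDcA_sub_le n M hlip κ ν hS'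
  have h2 : ‖conjMat κ W W D - D‖ ≤ ‖c‖ * θ := opNorm_conjMat_covDc_sub_le n M hlip κ ν hR'
  have hMn : ‖Mm‖ ≤ 1 + δ := (opNorm_le_one_add Mm).trans (by linarith)
  have hNn' : ‖Nn‖ ≤ 1 + δ := (opNorm_le_one_add Nn).trans (by linarith)
  have hXn : ‖X‖ ≤ (1 + δ) * δ := (Matrix.l2_opNorm_mul _ _).trans (mul_le_mul hNn' hM1 (norm_nonneg _) (by positivity))
  have hYn : ‖Y‖ ≤ δ * (1 + δ) := (Matrix.l2_opNorm_mul _ _).trans (mul_le_mul hN1 hMn (norm_nonneg _) hδ)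
  have hcθ : 0 ≤ ‖c‖ * θ := mul_nonneg (norm_nonneg _) hθ
  have hA : ‖c • ((conjMat κ W W Da - Da) * X)‖ ≤ ‖c‖ * ((‖c‖ * θ) * ((1 + δ) * δ)) := by
    rw [norm_smul]
    exact mul_le_mul_of_nonneg_left ((Matrix.l2_opNorm_mul _ _).trans (mul_le_mul h1 hXn (norm_nonneg _) hcθ)) (norm_nonneg _)
  have hB : ‖(starRingEnd ℂ) c • (Y * (conjMat κ W W D - D))‖ ≤ ‖c‖ * ((δ * (1 + δ)) * (‖c‖ * θ)) := by
    rw [norm_smul, Complex.norm_conj]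
    exact mul_le_mul_of_nonneg_left ((Matrix.l2_opNorm_mul _ _).trans (mul_le_mul hYn h2 (norm_nonneg _) (by positivity))) (norm_nonneg _)
  calc _ ≤ ‖c • ((conjMat κ W W Da - Da) * X)‖ + ‖(starRingEnd ℂ) c • (Y * (conjMat κ W W D - D))‖ := norm_add_le _ _
    _ ≤ ‖c‖ * ((‖c‖ * θ) * ((1 + δ) * δ)) + ‖c‖ * ((δ * (1 + δ)) * (‖c‖ * θ)) := add_le_add hA hB
    _ = 2 * ‖c‖ ^ 2 * θ * (δ * (1 + δ)) := by ring

/-- **CONJUGATION DEFECT OF THE LAPLACIAN CHART PERTURBATION**: `ConjDefect (Δ(e^{A}R⁰, (R⁰)⁻¹e^{−A}) − Δ_{R⁰}) κ ρ (d·2‖c‖²(e^{|κ|/n} − 1)δ(1+δ))`,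
`δ = ‖A‖e^{‖A‖}` (unitary `R⁰`, `1/n`-Lipschitz bond weight). [folklore] -/
theorem conjDefect_covLapT_chart (hR₀ : ∀ ν i, R₀ ν i ∈ Matrix.unitaryGroup o ℂ)
    (hlip : ∀ x μ ν', |ρ (x + unitVec (fine n M) ν', μ) - ρ (x, μ)| ≤ 1 / n) (κ : ℝ) (c : ℂ)
    (A : Fin d → (Tor (fine n M) × Fin d → Matrix o o ℂ)) :
    ConjDefect (covLapT (fine n M) c (expChart R₀ A) (expChartInv R₀ A) - covLapC (fine n M) c R₀) κ (rhoV n M ρ)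
      (d * (2 * ‖c‖ ^ 2 * (Real.exp (|κ| * (1 / n)) - 1) * ((‖A‖ * Real.exp ‖A‖) * (1 + ‖A‖ * Real.exp ‖A‖)))) := by
  refine conjDefect_of_opNorm ?_
  rw [covLapT_chart_sub_eq n M hR₀ c A, conjMat_finset_sum, ← Finset.sum_sub_distrib]
  refine (norm_sum_le _ _).trans ?_
  calc _ ≤ ∑ _ν : Fin d, 2 * ‖c‖ ^ 2 * (Real.exp (|κ| * (1 / n)) - 1) * ((‖A‖ * Real.exp ‖A‖) * (1 + ‖A‖ * Real.exp ‖A‖)) :=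
        Finset.sum_le_sum fun ν _ => opNorm_conjMat_lapTerm_sub_le n M hR₀ hlip κ c A ν (by positivity)
          (opNorm_Mfac_sub_one_le n M A ν) (opNorm_Nfac_sub_one_le n M A ν)
    _ = _ := by rw [Finset.sum_const, Finset.card_univ, Fintype.card_fin, nsmul_eq_mul]

end Laplacian

end Summit.QuantumFields.BalabanUV.T4Continuum.CovariantVectorChartConjugation

end
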